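import Mathlib.RingTheory.LocalRing.ResidueField.Basic
import Mathlib.RingTheory.Ideal.Maps
import Mathlib.RingTheory.Ideal.Operations
import HarnessLib

/-!
# An unramified local homomorphism with trivial residue extension is `𝔪`-adically dense ([CoP1] Prop. 9.3: "`R₁` lies dense in `R₁′`")

Topic: `Literature/AlgebraicGeometry/Resolution`. PROOF side of `CossartPiltant2019ReductionP`
(`ArithmeticalThreefoldsLocal.lean`), input (C4), DECOMPOSITION layer of [CoP1] Prop. 9.3
(hypothesis `hDec` of `cossartPiltant2019ReductionP_of_cjs_of_stableInertiaField`,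
`ArithmeticalThreefoldsLocalDescentInertiaClimb.lean`). In the printed proof (HAL p. 28):

> By (44), `Gˢ(R̃₁/R₁) = Gal(L/Kˢ) = Gal(L/QF(R₁′))`, so that `R₁′ ⊂ R₁ʰ`, where `R₁ʰ` is the
> Henselization of `R₁` ([40], theorem 2 on p.110). In particular, `R₁` lies dense in `R₁′` for
> the `m_{R₁′}`-adic topology. Let … `h_j ∈ R₁` be such that `h_j ≡ g_j mod m_{R₁′}^{C+1}`.

The density is the following elementary fact about a local homomorphism `f : A → B` of local
rings which is UNRAMIFIED at the closed point (`𝔪_A B = 𝔪_B`) with TRIVIAL RESIDUE EXTENSION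
(`A → B/𝔪_B` onto) — both hold for `R₁ → R₁′ ⊂ R₁ʰ`: every element of `B` is congruent to an
element of `f(A)` modulo any power of `𝔪_B`.

* `exists_sub_map_mem_pow_succ_of_mem_map_pow` — PROVED: the induction step (an element of
  `𝔪_A^n B` is `f(a) + 𝔪_B^{n+1}` with `a ∈ 𝔪_A^n`);
* `exists_sub_map_mem_maximalIdeal_pow` — PROVED: **density**: `∀ n b, ∃ a, b − f(a) ∈ 𝔪_B^n`;
* `surjective_quotient_maximalIdeal_pow_comp` — PROVED: `A → B/𝔪_B^n` is onto for every `n`.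

Everything is PROVED; no named facts, definitions, instances or notation are introduced.

## Sources

* V. Cossart, O. Piltant, J. Algebra 320 (2008) 1051–1082: proof of Prop. 9.3 (HAL
  hal-00139124, p. 28). [CossartPiltant2008]
* M. Nagata, *Local Rings* (1962), Thm. 2 p. 110 (as cited in [CoP1]). [folklore]
-/

namespace Literature.AlgebraicGeometry.Resolution

universe u v

open IsLocalRing

section Dense

variable {A : Type u} {B : Type v} [CommRing A] [CommRing B] [IsLocalRing A] [IsLocalRing B]
  (f : A →+* B)

/-- The induction step of the density: if `𝔪_B ⊆ f(A) + 𝔪_B²`-style approximation holds at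
order one (`A → B/𝔪_B` onto), then every element of `𝔪_A^n B` is `f(a)` with `a ∈ 𝔪_A^n` up to
`𝔪_B^{n+1}`. [cite: CossartPiltant2008, proof of Prop. 9.3 (HAL p. 28), "`R₁` lies dense in `R₁′`"] -/
theorem exists_sub_map_mem_pow_succ_of_mem_map_pow
    (hm : (maximalIdeal A).map f ≤ maximalIdeal B)
    (hres : ∀ b : B, ∃ a : A, b - f a ∈ maximalIdeal B) (n : ℕ) {b : B}
    (hb : b ∈ (maximalIdeal A ^ n).map f) :
    ∃ a ∈ maximalIdeal A ^ n, b - f a ∈ maximalIdeal B ^ (n + 1) := by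
  rw [Ideal.map, ← Ideal.submodule_span_eq] at hb
  refine Submodule.span_induction ?_ ?_ ?_ ?_ hb
  · rintro _ ⟨x, hx, rfl⟩
    exact ⟨x, hx, by rw [sub_self]; exact Ideal.zero_mem _⟩
  · exact ⟨0, Ideal.zero_mem _, by rw [map_zero, sub_self]; exact Ideal.zero_mem _⟩
  · rintro x y - - ⟨a₁, ha₁, hx⟩ ⟨a₂, ha₂, hy⟩
    refine ⟨a₁ + a₂, Ideal.add_mem _ ha₁ ha₂, ?_⟩
    have : x + y - f (a₁ + a₂) = (x - f a₁) + (y - f a₂) := by rw [map_add]; ring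
    rw [this]
    exact Ideal.add_mem _ hx hy
  · rintro c x - ⟨a, ha, hx⟩
    obtain ⟨a', ha'⟩ := hres c
    refine ⟨a' * a, Ideal.mul_mem_left _ _ ha, ?_⟩
    have : c • x - f (a' * a) = c * (x - f a) + (c - f a') * f a := by
      rw [smul_eq_mul, map_mul]; ring
    rw [this]
    refine Ideal.add_mem _ (Ideal.mul_mem_left _ _ hx) ?_
    rw [pow_succ']
    refine Ideal.mul_mem_mul ha' ?_
    have h1 : f a ∈ (maximalIdeal A ^ n).map f := Ideal.mem_map_of_mem f ha
    rw [Ideal.map_pow] at h1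
    exact Ideal.pow_right_mono hm n h1

/-- **Density of an unramified local homomorphism with trivial residue extension**: for a ring
homomorphism `f : A → B` of local rings with `𝔪_A B = 𝔪_B` and `A → B/𝔪_B` onto, every `b ∈ B`
is congruent to some `f(a)` modulo `𝔪_B^n`, for every `n` ("`R₁` lies dense in `R₁′` for the
`m_{R₁′}`-adic topology … let `h_j ∈ R₁` be such that `h_j ≡ g_j mod m_{R₁′}^{C+1}`").
[cite: CossartPiltant2008, proof of Prop. 9.3 (HAL p. 28)] -/
theorem exists_sub_map_mem_maximalIdeal_pow
    (hm : (maximalIdeal A).map f = maximalIdeal B)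
    (hres : ∀ b : B, ∃ a : A, b - f a ∈ maximalIdeal B) (n : ℕ) (b : B) :
    ∃ a : A, b - f a ∈ maximalIdeal B ^ n := by
  induction n generalizing b with
  | zero => exact ⟨0, by rw [pow_zero, Ideal.one_eq_top]; exact Submodule.mem_top⟩
  | succ n ih =>
    obtain ⟨a, ha⟩ := ih b
    rw [← hm, ← Ideal.map_pow] at ha
    obtain ⟨a', -, ha'⟩ := exists_sub_map_mem_pow_succ_of_mem_map_pow f hm.le hres n ha
    refine ⟨a + a', ?_⟩
    have : b - f (a + a') = b - f a - f a' := by rw [map_add]; ring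
    rwa [this]

/-- `A → B/𝔪_B^n` is onto, for every `n`. [cite: CossartPiltant2008, proof of Prop. 9.3 (HAL p. 28)] -/
theorem surjective_quotient_maximalIdeal_pow_comp
    (hm : (maximalIdeal A).map f = maximalIdeal B)
    (hres : ∀ b : B, ∃ a : A, b - f a ∈ maximalIdeal B) (n : ℕ) :
    Function.Surjective ((Ideal.Quotient.mk (maximalIdeal B ^ n)).comp f) := by
  intro x
  obtain ⟨b, rfl⟩ := Ideal.Quotient.mk_surjective x
  obtain ⟨a, ha⟩ := exists_sub_map_mem_maximalIdeal_pow f hm hres n b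
  refine ⟨a, ?_⟩
  rw [RingHom.comp_apply, Ideal.Quotient.eq]
  rw [← Ideal.neg_mem_iff, neg_sub]
  exact ha

end Dense

end Literature.AlgebraicGeometry.Resolution
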